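import Literature.MathematicalPhysics.QuantumFieldTheory.Balaban1983to89.T4AxialGaugeSmallField
import HarnessLib

/-!
# LINE 30 «CurvaturePoincare» — ladder SUMS for the axial gauge (group level): the located non-abelian Stokes bound in `ℓ¹` form,
# and the three bond directions of a `d = 3` box in the axial gauge rooted at an INTERIOR point of an edge

Crux of record `PoincareLipschitz.MesoscopicConcentrationL` (stmt-QuantumFields-23532; LINE 30 skeleton `Cruxes/HistoryTailL/Lines/curvature_poincare.lean`
sha16 e95b7bfb5ac8bc91, ideator ym-r3-idea-2 g16), stub (NP) `stub_curvaturePinning`; cell `ym3-torus` (YM ladder rung R3 = continuum `SU(2)` Yang–Mills on T³ —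
a RUNG, NOT the Clay problem); width seat `ym3-torus-px19` gen 9.  THIS FILE = the group-level half of the «averaged axial gauges» road; the torus half and the
registered stub are in `CurvaturePoincareStubCurvaturePinning`.

WHAT IS PROVED (any `[GaugeGroup G]`, configurations `V : ℤ^d → (Fin d → G)` in the word calculus of `B7Prop1Explicit` ∕ `B8Lemma1NonAbelian`, used BY NAME):
* §1 (any `d`) the ladder over a STRAIGHT SEGMENT in `ℓ¹`-form: `dist₁(V(ladder (seg κ m ++ w₂) μ)) ≤ Σ_{plaquettes (κ,μ) met along the segment} dist₁(V(∂p)) + (bound for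
  the tail ladder over `w₂`)` — forward AND backward segments (`dist1_hol_lplaqWord_false`: a backward letter meets the inverse-conjugate of the plaquette one
  step back) —, and its CRUDE LINE FORM `dist1_hol_ladder_seg_le_line`: if the segment runs inside `[0, N]·e_κ` above a base point, the sum over the plaquettes met is
  at most the sum over ALL `N` plaquettes `(κ, μ)` of that line (non-negativity; no located count is kept).
* §2 (`d = 3`) in the axial gauge of `B7Prop1Explicit.axialFn` ROOTED AT `y = lo + r·e₀` (a point of the bottom edge of the box `lo + [0, N]³`, NOT the corner), for the
  bond at `x = lo + v₀e₀ + v₁e₁ + v₂e₂`: direction `0` is a tree bond (`= 1`); direction `1` is bounded by the `(0,1)`-plaquettes of the line `lo + ℤe₀ + v₁e₁ + v₂e₂`;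
  direction `2` by the `(1,2)`-plaquettes of the line `lo + r e₀ + ℤe₁ + v₂e₂` (the «spine plane» `{x₀ = lo₀ + r}` — the only place where the root enters) plus the
  `(0,2)`-plaquettes of the line `lo + ℤe₀ + v₁e₁ + v₂e₂` (`B8Lemma1NonAbelian.axial_bond_eq_sharp` + the literal `d = 3` tree word
  `treeWord u = seg 2 (u 2) ++ seg 1 (u 1) ++ seg 0 (u 0)`).
Averaging over the `N + 1` roots `r` is what makes the congestion of every plaquette `O(n)` instead of `O(n²)` (torus file).

HONEST SCOPE.  Deterministic word bookkeeping; proves NOTHING of `stub_curvaturePinning` by itself (that is the torus file), nothing of LM ∕ B♯ ∕ R♯, K1 (23532), 23083,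
`HistoryTailL` (19936), EX (19200), 20520 or rung R3; R3 = continuum `SU(2)` YM on T³ — NOT d = 4, NOT infinite volume, NOT a mass gap, NOT Clay.
THEOREMS ONLY (0 `def`, 0 `sorry`); `--supports stmt-QuantumFields-23532`.

References: M. Creutz, «Quarks, gluons and lattices» (1983) ch. 9 (maximal trees ∕ axial gauge) [folklore]; T. Bałaban, CMP 98 (1985) 17–51, pp. 24–25
[Balaban1985Averaging] (the tree-gauge bond identity, typed as `axial_bond_eq_sharp`).
-/

set_option autoImplicit false

open scoped BigOperators
open Literature.MathematicalPhysics.QuantumFieldTheory.Balaban1983to89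
open Literature.MathematicalPhysics.QuantumFieldTheory.Balaban1983to89.B7Prop1Explicit
  (Letter e e_apply disp disp_nil disp_cons hol hol_nil hol_cons stepHol stepHol_true stepHol_false gaugeAct hol_gaugeAct_closed
  treeWord plaqWord lplaqWord lplaqWord_true hol_lplaqWord disp_plaqWord ladder hol_ladder hol_ladder_cons axialFn seg seg_natCast
  seg_zero seg_neg_natCast)
open Literature.MathematicalPhysics.QuantumFieldTheory.Balaban1983to89.B8Lemma1NonAbelian
  (lowPart lowPart_apply axial_bond_eq_sharp axial_treeBond_eq_one treeWord_zsmul_e)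
open Literature.MathematicalPhysics.QuantumFieldTheory.Balaban1983to89.B11GaugeGlue (dist1_conj_inv)

namespace Summit.QuantumFields.YangMills.Theorems.CurvaturePoincareAxialLadderSums

/-! ## §1 Ladder sums along straight segments (any dimension) -/

section Segments

variable {d : ℕ} {G : Type*} [GaugeGroup G]

/-- The ladder over the empty word is the trivial loop `[x, x+e_μ] ∪ [x+e_μ, x]`: holonomy `1`. [folklore] -/
theorem hol_ladder_nil (V : B7Prop1Explicit.Site d → Fin d → G) (x : B7Prop1Explicit.Site d) (μ : Fin d) :
    hol V x (ladder [] μ) = 1 := by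
  rw [hol_ladder]
  simp

/-- A BACKWARD letter `−e_κ` at `x` meets, in the ladder recursion, a loop whose `dist₁` is that of the plaquette `(κ, μ)` based ONE STEP BACK at
`x − e_κ` (it is the conjugate by `V(x − e_κ, x)⁻¹` of the inverse plaquette holonomy). [folklore] -/
theorem dist1_hol_lplaqWord_false (V : B7Prop1Explicit.Site d → Fin d → G) (x : B7Prop1Explicit.Site d) (κ μ : Fin d) :
    dist1 (hol V x (lplaqWord (κ, false) μ)) = dist1 (hol V (x - e κ) (plaqWord κ μ)) := by
  have h : hol V x (lplaqWord (κ, false) μ) =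
      (V (x - e κ) κ)⁻¹ * (hol V (x - e κ) (plaqWord κ μ))⁻¹ * (V (x - e κ) κ) := by
    rw [← lplaqWord_true, hol_lplaqWord, hol_lplaqWord]
    simp only [stepHol_true, stepHol_false, Letter.vec_true, Letter.vec_false, inv_inv, mul_inv_rev]
    rw [show x + -e κ = x - e κ by abel, show x - e κ + e κ = x by abel, show x + e μ - e κ = x - e κ + e μ by abel]
    group
  rw [h, dist1_conj_inv, GaugeGroup.dist1_inv]

/-- FORWARD SEGMENT WITH A TAIL: walking `k` steps `+e_κ` from `x` and then the word `w₂`, the ladder's `dist₁` is at most the `dist₁`'s of the `k` plaquettes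
`(κ, μ)` based at `x, x + e_κ, …, x + (k−1)e_κ` plus any bound `B` for the tail ladder from `x + k·e_κ`. [folklore] -/
theorem dist1_hol_ladder_replicate_true_le (V : B7Prop1Explicit.Site d → Fin d → G) (κ μ : Fin d) (w₂ : List (Letter d)) (B : ℝ) :
    ∀ (k : ℕ) (x : B7Prop1Explicit.Site d), dist1 (hol V (x + (k : ℤ) • e κ) (ladder w₂ μ)) ≤ B →
      dist1 (hol V x (ladder (List.replicate k (κ, true) ++ w₂) μ)) ≤
        (∑ t ∈ Finset.range k, dist1 (hol V (x + (t : ℤ) • e κ) (plaqWord κ μ))) + B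
  | 0, x, hB => by simpa using hB
  | k + 1, x, hB => by
    have hend : x + e κ + (k : ℤ) • e κ = x + ((k + 1 : ℕ) : ℤ) • e κ := by
      push_cast
      rw [add_smul, one_smul]
      abel
    have ih := dist1_hol_ladder_replicate_true_le V κ μ w₂ B k (x + e κ) (by rw [hend]; exact hB)
    rw [List.replicate_succ, List.cons_append, hol_ladder_cons, Finset.sum_range_succ']
    calc dist1 (stepHol V x (κ, true) * hol V (x + Letter.vec (κ, true)) (ladder (List.replicate k (κ, true) ++ w₂) μ) *
            (stepHol V x (κ, true))⁻¹ * hol V x (lplaqWord (κ, true) μ))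
        ≤ dist1 (stepHol V x (κ, true) * hol V (x + Letter.vec (κ, true)) (ladder (List.replicate k (κ, true) ++ w₂) μ) *
            (stepHol V x (κ, true))⁻¹) + dist1 (hol V x (lplaqWord (κ, true) μ)) := GaugeGroup.dist1_mul_le _ _
      _ = dist1 (hol V (x + e κ) (ladder (List.replicate k (κ, true) ++ w₂) μ)) + dist1 (hol V x (plaqWord κ μ)) := by
          rw [GaugeGroup.dist1_conj, Letter.vec_true, lplaqWord_true]
      _ ≤ ((∑ t ∈ Finset.range k, dist1 (hol V (x + e κ + (t : ℤ) • e κ) (plaqWord κ μ))) + B) +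
            dist1 (hol V x (plaqWord κ μ)) := add_le_add ih le_rfl
      _ = (∑ t ∈ Finset.range k, dist1 (hol V (x + ((t + 1 : ℕ) : ℤ) • e κ) (plaqWord κ μ))) +
            dist1 (hol V (x + ((0 : ℕ) : ℤ) • e κ) (plaqWord κ μ)) + B := by
          have hpt : ∀ t : ℕ, x + e κ + (t : ℤ) • e κ = x + ((t + 1 : ℕ) : ℤ) • e κ := fun t => by
            push_cast
            rw [add_smul, one_smul]
            abel
          simp only [hpt, Nat.cast_zero, zero_smul, add_zero]
          ring

/-- BACKWARD SEGMENT WITH A TAIL: walking `k` steps `−e_κ` from `x + k·e_κ` down to `x` and then `w₂`, the ladder's `dist₁` is at most the `dist₁`'s of the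
`k` plaquettes `(κ, μ)` based at `x, …, x + (k−1)e_κ` plus any bound `B` for the tail ladder from `x`. [folklore] -/
theorem dist1_hol_ladder_replicate_false_le (V : B7Prop1Explicit.Site d → Fin d → G) (κ μ : Fin d) (w₂ : List (Letter d)) (B : ℝ)
    (x : B7Prop1Explicit.Site d) (hB : dist1 (hol V x (ladder w₂ μ)) ≤ B) :
    ∀ k : ℕ, dist1 (hol V (x + (k : ℤ) • e κ) (ladder (List.replicate k (κ, false) ++ w₂) μ)) ≤
        (∑ t ∈ Finset.range k, dist1 (hol V (x + (t : ℤ) • e κ) (plaqWord κ μ))) + B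
  | 0 => by simpa using hB
  | k + 1 => by
    have ih := dist1_hol_ladder_replicate_false_le V κ μ w₂ B x hB k
    have hstep : x + ((k + 1 : ℕ) : ℤ) • e κ + Letter.vec (κ, false) = x + (k : ℤ) • e κ := by
      rw [Letter.vec_false]
      push_cast
      rw [add_smul, one_smul]
      abel
    have hback : x + ((k + 1 : ℕ) : ℤ) • e κ - e κ = x + (k : ℤ) • e κ := by
      push_cast
      rw [add_smul, one_smul]
      abel
    rw [List.replicate_succ, List.cons_append, hol_ladder_cons, Finset.sum_range_succ, hstep]
    calc dist1 (stepHol V (x + ((k + 1 : ℕ) : ℤ) • e κ) (κ, false) * hol V (x + (k : ℤ) • e κ) (ladder (List.replicate k (κ, false) ++ w₂) μ) *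
            (stepHol V (x + ((k + 1 : ℕ) : ℤ) • e κ) (κ, false))⁻¹ * hol V (x + ((k + 1 : ℕ) : ℤ) • e κ) (lplaqWord (κ, false) μ))
        ≤ dist1 (stepHol V (x + ((k + 1 : ℕ) : ℤ) • e κ) (κ, false) * hol V (x + (k : ℤ) • e κ) (ladder (List.replicate k (κ, false) ++ w₂) μ) *
            (stepHol V (x + ((k + 1 : ℕ) : ℤ) • e κ) (κ, false))⁻¹) + dist1 (hol V (x + ((k + 1 : ℕ) : ℤ) • e κ) (lplaqWord (κ, false) μ)) :=
          GaugeGroup.dist1_mul_le _ _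
      _ = dist1 (hol V (x + (k : ℤ) • e κ) (ladder (List.replicate k (κ, false) ++ w₂) μ)) +
            dist1 (hol V (x + (k : ℤ) • e κ) (plaqWord κ μ)) := by
          rw [GaugeGroup.dist1_conj, dist1_hol_lplaqWord_false, hback]
      _ ≤ ((∑ t ∈ Finset.range k, dist1 (hol V (x + (t : ℤ) • e κ) (plaqWord κ μ))) + B) +
            dist1 (hol V (x + (k : ℤ) • e κ) (plaqWord κ μ)) := add_le_add ih le_rfl
      _ = (∑ t ∈ Finset.range k, dist1 (hol V (x + (t : ℤ) • e κ) (plaqWord κ μ))) +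
            dist1 (hol V (x + (k : ℤ) • e κ) (plaqWord κ μ)) + B := by ring

/-- A window of `k` consecutive indices starting at `c₀` inside `[0, N)` carries at most the full sum of a non-negative sequence. [folklore] -/
theorem sum_range_shift_le_sum_range {f : ℕ → ℝ} (hf : ∀ t, 0 ≤ f t) {c₀ k N : ℕ} (h : c₀ + k ≤ N) :
    ∑ t ∈ Finset.range k, f (c₀ + t) ≤ ∑ t ∈ Finset.range N, f t := by
  have hmap : ∑ t ∈ Finset.range k, f (c₀ + t) = ∑ t ∈ (Finset.range k).map (addLeftEmbedding c₀), f t := by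
    rw [Finset.sum_map]
    rfl
  rw [hmap]
  refine Finset.sum_le_sum_of_subset_of_nonneg (fun t ht => ?_) fun t _ _ => hf t
  rw [Finset.mem_map] at ht
  obtain ⟨s, hs, rfl⟩ := ht
  rw [Finset.mem_range] at hs ⊢
  simp only [addLeftEmbedding_apply]
  omega

/-- **THE CRUDE LINE FORM.**  A segment of the line `base + ℤ·e_κ` from height `c` to height `c'` (both in `[0, N]`, either order), followed by a tail `w₂`
whose ladder from the endpoint `base + c'·e_κ` is bounded by `B`: the ladder's `dist₁` is at most the sum over ALL `N` plaquettes `(κ, μ)` based at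
`base + t·e_κ`, `0 ≤ t < N`, plus `B`. [folklore] -/
theorem dist1_hol_ladder_seg_le_line (V : B7Prop1Explicit.Site d → Fin d → G) (κ μ : Fin d) (w₂ : List (Letter d)) (B : ℝ)
    (base : B7Prop1Explicit.Site d) {N c c' : ℕ} (hc : c ≤ N) (hc' : c' ≤ N)
    (hB : dist1 (hol V (base + (c' : ℤ) • e κ) (ladder w₂ μ)) ≤ B) :
    dist1 (hol V (base + (c : ℤ) • e κ) (ladder (seg κ ((c' : ℤ) - (c : ℤ)) ++ w₂) μ)) ≤
      (∑ t ∈ Finset.range N, dist1 (hol V (base + (t : ℤ) • e κ) (plaqWord κ μ))) + B := by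
  have hf : ∀ t : ℕ, 0 ≤ dist1 (hol V (base + (t : ℤ) • e κ) (plaqWord κ μ)) := fun t => GaugeGroup.dist1_nonneg _
  have hpt : ∀ c₀ t : ℕ, base + (c₀ : ℤ) • e κ + (t : ℤ) • e κ = base + ((c₀ + t : ℕ) : ℤ) • e κ := fun c₀ t => by
    push_cast
    rw [add_smul]
    abel
  rcases le_or_gt c c' with h | h
  · -- forward segment of `k = c' − c` steps
    obtain ⟨k, rfl⟩ : ∃ k, c' = c + k := ⟨c' - c, by omega⟩
    have hk : ((c + k : ℕ) : ℤ) - (c : ℤ) = ((k : ℕ) : ℤ) := by push_cast; ring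
    rw [hk, seg_natCast]
    have hB' : dist1 (hol V (base + (c : ℤ) • e κ + (k : ℤ) • e κ) (ladder w₂ μ)) ≤ B := by rwa [hpt]
    refine (dist1_hol_ladder_replicate_true_le V κ μ w₂ B k _ hB').trans (add_le_add ?_ le_rfl)
    simp only [hpt]
    exact sum_range_shift_le_sum_range hf (by omega)
  · -- backward segment of `k = c − c'` steps
    obtain ⟨k, rfl⟩ : ∃ k, c = c' + k := ⟨c - c', by omega⟩
    have hk : ((c' : ℕ) : ℤ) - ((c' + k : ℕ) : ℤ) = -((k : ℕ) : ℤ) := by push_cast; ring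
    rw [hk, seg_neg_natCast, ← hpt]
    refine (dist1_hol_ladder_replicate_false_le V κ μ w₂ B _ hB k).trans (add_le_add ?_ le_rfl)
    simp only [hpt]
    exact sum_range_shift_le_sum_range hf (by omega)

/-- A closed loop's `dist₁` is gauge invariant: the plaquette holonomies of `V^u` and `V` have the same `dist₁`. [folklore] -/
theorem dist1_hol_gaugeAct_plaqWord (u : B7Prop1Explicit.Site d → G) (V : B7Prop1Explicit.Site d → Fin d → G)
    (z : B7Prop1Explicit.Site d) (κ μ : Fin d) :
    dist1 (hol (gaugeAct u V) z (plaqWord κ μ)) = dist1 (hol V z (plaqWord κ μ)) := by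
  rw [hol_gaugeAct_closed _ _ _ _ (disp_plaqWord _ _), GaugeGroup.dist1_conj]

end Segments

/-! ## §2 `d = 3`: the three bond directions in the axial gauge rooted at a point `lo + r·e₀` of the bottom edge -/

section Three

variable {G : Type*} [GaugeGroup G]

/-- The tree word in three dimensions: first direction `2`, then `1`, then `0` (definitional unfolding of `B7Prop1Explicit.treeWord`). [folklore] -/
theorem treeWord_three (u : B7Prop1Explicit.Site 3) : treeWord u = seg 2 (u 2) ++ (seg 1 (u 1) ++ (seg 0 (u 0) ++ [])) := rfl

/-- `lowPart 0 = 0` (no direction lies below `0`). [folklore] -/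
theorem lowPart_zero_three (u : B7Prop1Explicit.Site 3) : lowPart 0 u = 0 := by
  funext κ
  simp [lowPart_apply]

/-- `lowPart 1 u = u₀·e₀` in three dimensions. [folklore] -/
theorem lowPart_one_three (u : B7Prop1Explicit.Site 3) : lowPart 1 u = (u 0) • e 0 := by
  funext κ
  fin_cases κ <;> simp [lowPart_apply, e_apply]

/-- `lowPart 2 u = u₀·e₀ + u₁·e₁` in three dimensions. [folklore] -/
theorem lowPart_two_three (u : B7Prop1Explicit.Site 3) : lowPart 2 u = (u 0) • e 0 + (u 1) • e 1 := by
  funext κ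
  fin_cases κ <;> simp [lowPart_apply, e_apply]

/-- **DIRECTION 0 IS A TREE BOND**: in the axial gauge rooted at any `y`, `V^y(x, x + e₀) = 1`. [folklore] -/
theorem axial_bond_zero_eq_one (V : B7Prop1Explicit.Site 3 → Fin 3 → G) (y x : B7Prop1Explicit.Site 3) :
    gaugeAct (axialFn V y) V x 0 = 1 :=
  axial_treeBond_eq_one V y x 0 (lowPart_zero_three _)

/-- **DIRECTION 1**: rooted at `y = lo + r·e₀` (`r ≤ N`), the bond at `x = lo + v₀e₀ + v₁e₁ + v₂e₂` (`v₀ ≤ N`) is bounded by the `(0,1)`-plaquettes of the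
line `lo + t·e₀ + v₁e₁ + v₂e₂`, `0 ≤ t < N` (the ladder runs along `e₀` between heights `r` and `v₀`). [folklore] -/
theorem dist1_axial_bond_one_le (V : B7Prop1Explicit.Site 3 → Fin 3 → G) (lo : B7Prop1Explicit.Site 3) {N r v₀ : ℕ} (v₁ v₂ : ℕ)
    (hr : r ≤ N) (hv₀ : v₀ ≤ N) :
    dist1 (gaugeAct (axialFn V (lo + (r : ℤ) • e 0)) V (lo + (v₀ : ℤ) • e 0 + (v₁ : ℤ) • e 1 + (v₂ : ℤ) • e 2) 1) ≤
      ∑ t ∈ Finset.range N, dist1 (hol V (lo + (t : ℤ) • e 0 + (v₁ : ℤ) • e 1 + (v₂ : ℤ) • e 2) (plaqWord 0 1)) := by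
  have hLo : lowPart 1 ((lo + (v₀ : ℤ) • e 0 + (v₁ : ℤ) • e 1 + (v₂ : ℤ) • e 2) - (lo + (r : ℤ) • e 0)) = ((v₀ : ℤ) - (r : ℤ)) • e 0 := by
    rw [lowPart_one_three]
    congr 1
    simp [e_apply]
  have hw : (lo + (v₀ : ℤ) • e 0 + (v₁ : ℤ) • e 1 + (v₂ : ℤ) • e 2) -
      lowPart 1 ((lo + (v₀ : ℤ) • e 0 + (v₁ : ℤ) • e 1 + (v₂ : ℤ) • e 2) - (lo + (r : ℤ) • e 0)) =
      (lo + (v₁ : ℤ) • e 1 + (v₂ : ℤ) • e 2) + (r : ℤ) • e 0 := by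
    rw [hLo, sub_smul]
    abel
  rw [axial_bond_eq_sharp, dist1_conj_inv, hw, hLo, treeWord_zsmul_e, ← List.append_nil (seg 0 _)]
  set V₀ := gaugeAct (axialFn V (lo + (r : ℤ) • e 0)) V with hV₀
  have hB : dist1 (hol V₀ (lo + (v₁ : ℤ) • e 1 + (v₂ : ℤ) • e 2 + (v₀ : ℤ) • e 0) (ladder [] 1)) ≤ 0 := by
    rw [hol_ladder_nil, GaugeGroup.dist1_one]
  refine (dist1_hol_ladder_seg_le_line V₀ 0 1 [] 0 _ hr hv₀ hB).trans (le_of_eq ?_)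
  rw [add_zero]
  refine Finset.sum_congr rfl fun t _ => ?_
  rw [hV₀, dist1_hol_gaugeAct_plaqWord, show lo + (v₁ : ℤ) • e 1 + (v₂ : ℤ) • e 2 + (t : ℤ) • e 0 =
    lo + (t : ℤ) • e 0 + (v₁ : ℤ) • e 1 + (v₂ : ℤ) • e 2 by abel]

/-- **DIRECTION 2**: rooted at `y = lo + r·e₀` (`r ≤ N`), the bond at `x = lo + v₀e₀ + v₁e₁ + v₂e₂` (`v₀, v₁ ≤ N`) is bounded by the `(1,2)`-plaquettes of the
line `lo + r·e₀ + s·e₁ + v₂e₂`, `0 ≤ s < N` (the spine plane `x₀ = lo₀ + r` — the only dependence on the root) plus the `(0,2)`-plaquettes of the line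
`lo + t·e₀ + v₁e₁ + v₂e₂`, `0 ≤ t < N`. [folklore] -/
theorem dist1_axial_bond_two_le (V : B7Prop1Explicit.Site 3 → Fin 3 → G) (lo : B7Prop1Explicit.Site 3) {N r v₀ v₁ : ℕ} (v₂ : ℕ)
    (hr : r ≤ N) (hv₀ : v₀ ≤ N) (hv₁ : v₁ ≤ N) :
    dist1 (gaugeAct (axialFn V (lo + (r : ℤ) • e 0)) V (lo + (v₀ : ℤ) • e 0 + (v₁ : ℤ) • e 1 + (v₂ : ℤ) • e 2) 2) ≤
      (∑ s ∈ Finset.range N, dist1 (hol V (lo + (r : ℤ) • e 0 + (s : ℤ) • e 1 + (v₂ : ℤ) • e 2) (plaqWord 1 2))) +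
        ∑ t ∈ Finset.range N, dist1 (hol V (lo + (t : ℤ) • e 0 + (v₁ : ℤ) • e 1 + (v₂ : ℤ) • e 2) (plaqWord 0 2)) := by
  have hLo : lowPart 2 ((lo + (v₀ : ℤ) • e 0 + (v₁ : ℤ) • e 1 + (v₂ : ℤ) • e 2) - (lo + (r : ℤ) • e 0)) =
      ((v₀ : ℤ) - (r : ℤ)) • e 0 + (v₁ : ℤ) • e 1 := by
    rw [lowPart_two_three]
    congr 1
    · congr 1
      simp [e_apply]
    · congr 1
      simp [e_apply]
  have hTW : treeWord (lowPart 2 ((lo + (v₀ : ℤ) • e 0 + (v₁ : ℤ) • e 1 + (v₂ : ℤ) • e 2) - (lo + (r : ℤ) • e 0))) =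
      seg 1 ((v₁ : ℤ) - ((0 : ℕ) : ℤ)) ++ (seg 0 ((v₀ : ℤ) - (r : ℤ)) ++ []) := by
    rw [treeWord_three, hLo]
    simp [e_apply, seg_zero]
  have hw : (lo + (v₀ : ℤ) • e 0 + (v₁ : ℤ) • e 1 + (v₂ : ℤ) • e 2) -
      lowPart 2 ((lo + (v₀ : ℤ) • e 0 + (v₁ : ℤ) • e 1 + (v₂ : ℤ) • e 2) - (lo + (r : ℤ) • e 0)) =
      (lo + (r : ℤ) • e 0 + (v₂ : ℤ) • e 2) + ((0 : ℕ) : ℤ) • e 1 := by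
    rw [hLo, sub_smul, Nat.cast_zero, zero_smul, add_zero]
    abel
  rw [axial_bond_eq_sharp, dist1_conj_inv, hw, hTW]
  set V₀ := gaugeAct (axialFn V (lo + (r : ℤ) • e 0)) V with hV₀
  -- the tail: the `e₀`-segment from height `r` to height `v₀` above `lo + v₁e₁ + v₂e₂`
  have hB0 : dist1 (hol V₀ (lo + (v₁ : ℤ) • e 1 + (v₂ : ℤ) • e 2 + (v₀ : ℤ) • e 0) (ladder [] 2)) ≤ 0 := by
    rw [hol_ladder_nil, GaugeGroup.dist1_one]
  have htail := dist1_hol_ladder_seg_le_line V₀ 0 2 [] 0 (lo + (v₁ : ℤ) • e 1 + (v₂ : ℤ) • e 2) hr hv₀ hB0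
  rw [add_zero, show lo + (v₁ : ℤ) • e 1 + (v₂ : ℤ) • e 2 + (r : ℤ) • e 0 = lo + (r : ℤ) • e 0 + (v₂ : ℤ) • e 2 + (v₁ : ℤ) • e 1 by abel] at htail
  refine (dist1_hol_ladder_seg_le_line V₀ 1 2 _ _ (lo + (r : ℤ) • e 0 + (v₂ : ℤ) • e 2) (Nat.zero_le N) hv₁ htail).trans (le_of_eq ?_)
  congr 1
  · refine Finset.sum_congr rfl fun s _ => ?_
    rw [hV₀, dist1_hol_gaugeAct_plaqWord, show lo + (r : ℤ) • e 0 + (v₂ : ℤ) • e 2 + (s : ℤ) • e 1 =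
      lo + (r : ℤ) • e 0 + (s : ℤ) • e 1 + (v₂ : ℤ) • e 2 by abel]
  · refine Finset.sum_congr rfl fun t _ => ?_
    rw [hV₀, dist1_hol_gaugeAct_plaqWord, show lo + (v₁ : ℤ) • e 1 + (v₂ : ℤ) • e 2 + (t : ℤ) • e 0 =
      lo + (t : ℤ) • e 0 + (v₁ : ℤ) • e 1 + (v₂ : ℤ) • e 2 by abel]

end Three

end Summit.QuantumFields.YangMills.Theorems.CurvaturePoincareAxialLadderSums
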